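import Summits.ABC.IUTFork.MLFGaloisStronglyCompleteUnconditional
import Literature.AnabelianGeometry.AbsoluteAnabelian.MLFGaloisLogFrobeniusFactorizationTIso
import Literature.AnabelianGeometry.AbsoluteAnabelian.MonoidKummerMapsIdRigidProofs
import Literature.AnabelianGeometry.AbsoluteAnabelian.MonoidKummerMapsIdRigidTFInjProofs
import Literature.AnabelianGeometry.AbsoluteAnabelian.MonoidKummerMapsIdRigidTGProofs
import Literature.AnabelianGeometry.AbsoluteAnabelian.AbsTopIProp23SlimProofs
import Literature.AnabelianGeometry.AbsoluteAnabelian.SlimTransport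
import HarnessLib

/-!
# [AbsTopIII] Prop 3.2 (iv) — node-level assembly of the four printed sentences, `T ∈ {TM, TF}`
# (cone node AbsTopIII:Prop3.2(iv); proof-only; binders = printed inputs BY NAME)

S. Mochizuki, *Topics in Absolute Anabelian Geometry III* (2015) [MochizukiAbsTopIII2015], Prop. 3.2 (iv),
kurims manuscript p. 72 l. 16–28 (lit key `paper:url-5493eb38cbb7`, read on the page), as CORRECTED by the
author's «Comments on [AbsTopIII]» (June 2019) item (5) [MochizukiAbsTopIIIComments2019]:

1. «the natural functor of Definition 3.1, (iii), induces an injection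
   `Isom_{𝒞^MLF_T}((Π ↷ M_T),(Π* ↷ M*_T)) ↪ Isom_{𝒯𝒢}(Π, Π*)`» (`T ∈ {TM, TF}`);
2. «this injection is a bijection if `T = TM` [Comments (5): and `(Π ↷ M_T)`, `(Π* ↷ M*_T)` are of hyperbolic
   orbicurve type], or if [`T` is either `TM` or `TF`, and] `(Π ↷ M_T)`, `(Π* ↷ M*_T)` are of strictly Belyi type»;
3. «if `(Π ↷ M_T)` is of hyperbolic orbicurve type, then the group `Aut_{𝒞^MLF_T}((Π ↷ M_T))` — which is
   isomorphic to a subgroup of `Aut_{𝒯𝒢}(Π)` that contains the subgroup of `Aut_{𝒯𝒢}(Π)` determined by the inner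
   automorphisms of `Π` — is center-free»;
4. «the categories `𝒯𝒢^hyp`, `𝒯𝒢^sB`, `𝒯𝒢̲^hyp`, `𝒯𝒢̲^sB`, `𝒞^{MLF-hyp}_T`, `𝒞^{MLF-sB}_T`, `𝒞̲^{MLF-hyp}_T`,
   `𝒞̲^{MLF-sB}_T` are id-rigid».

Printed proof p. 72 l. 45 – p. 73 l. 4: injectivity ⇐ (i), (ii); centre-freeness ⇐ injectivity + «the slimness
of `Π` [cf. [Mzk20], Proposition 2.3, (ii)]»; surjectivity ⇐ «assertion (iii), when … of strictly Belyi type»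
and ⇐ local class field theory «[Mzk9], Proposition 1.2.1, (iii), (iv) … together with assertions (i), (ii)»
when `T = TM`.

Cell abc-iut (run/shared/lean/pub/abc-iut/), R-C discharge of cone node AbsTopIII:Prop3.2(iv) (typed statement
of record abc-iut-L4-t2 `MonoidKummerMaps.lean` p406795 + abc-iut-w4-d045 `MonoidKummerMapsSub.lean` p413741;
sub-DAG `plan/L4/SUBDAG-AbsTopIII-Prop32.md` rows P32.iv.L13–L17).  PROOF-ONLY (no definition, no instance):
every printed sentence of (iv) is closed BY NAME from landed theorems, and the node is assembled as ONE
conjunction `absTopIII_prop32iv` whose explicit `Prop`-binders are exactly the printed inputs: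

* sentence 1 — ZERO binders: `pairIsoDeterminedByGalois_holds` (`TM`, abc-iut-L6-t13 p408132),
  `fieldPairIsoDeterminedByGalois_holds` (`TF`, abc-iut-w4-d045 p416253);
* sentence 2, `T = TM` — ZERO binders, for EVERY hypothesis predicate `H` (hyperbolic orbicurve type AND strictly
  Belyi type): `Summit.ABC.IUTFork.galoisIsoLiftsToTMPairIso_holds` (abc-iut-w6-d103 p445855: Nikolov–Segal at
  `G_k` + local class field theory, the printed `TM` route) — this file adds the strictly-Belyi `TM` schema
  `galoisIsoLiftsToTMPairIsoOfStrictlyBelyi_holds` (FACT-LIST F-2994, universal closure, unconditional);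
* sentence 2, `T = TF`, strictly Belyi type — ONE binder = Prop. 3.2 (iii) BY NAME («the algorithm of (iii)»,
  functorial «relative to `𝒞̲^MLF_T`», as the datum `Prop32iiiAlgorithmTIso S` of abc-iut-L4-t9 on the class `S`
  of pairs of strictly Belyi type; its intended instance is Cor. 1.10 (h), campaign L): abc-iut-L4-t9's
  `galoisIsoLiftsToTFPairIso_of_nonempty_prop32iiiAlgorithmTIso` p437065 (over the residual identification
  p432307) — print's «surjectivity … follows from assertion (iii)»;
* sentence 3 — Inn(Π) ⊆ image: `GaloisMonoidPair.Iso.conj` / `GaloisFieldPair.Iso.conj` (CONSTRUCTED, w4-d045);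
  centre-free: ONE binder = [AbsTopI] Prop. 2.3 (ii) BY NAME, in the shape «every `H`-pair has `Π ≅ Π_X` for an
  extension `1 → Δ → Π_X → G → 1` satisfying `FundamentalExtension.ArithSlimNotElastic`» (FACT-LIST F-0238, the
  typed [AbsTopI] Prop. 2.3 (ii)); the deduction is abc-iut-L6-t13's `autPairCenterFree_of_isSlimGroup` p408338 /
  w4-d045's `autFieldPairCenterFree_of_isSlimGroup'`; ALSO from [AbsTopI] Prop. 2.3 (i) (`Δ` slim) + MLF base data,
  the `Π`-slimness step being a theorem of the tree (`FundamentalExtension.MLFBase.isSlimGroup_arith`);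
* sentence 4 — same binder: `𝒞^{MLF-H}_TM` (`prop32iv_idRigid_TM_of_isSlimGroup` p414730), `𝒞^{MLF-H}_TF`
  (`prop32iv_idRigidTF_of_isSlimGroup'` p416253), `𝒯𝔾^H` at abc-iut-L4-t9's model groupoid of topological groups
  (`isIdRigid_topGroupSubcat_of_isSlimGroup` p416688), and — NEW here — the UNDERLINED (isomorphism-subcategory)
  versions `𝒞̲^{MLF-H}_TM = Core 𝒞^{MLF-H}_TM`, `𝒞̲^{MLF-H}_TF` (`isIdRigid_core_of_iso_comm_eq_refl`: §0's criterion
  run on Mathlib's `Core`).  Not typed in the tree, hence not covered: the non-underlined `𝒯𝒢^H` (continuous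
  homomorphisms inducing open injections on arithmetic quotients; the tree's `TopGroupObj` is the groupoid).

HONEST FRAMING: refereed, undisputed [AbsTopIII] material; OUR kernel theorems about OUR typings; a binder BY NAME
is an assumption label (Prop. 3.2 (iii) on the strictly-Belyi class is NOT asserted — its universal closure over
all compact-`Π` `TF`-pairs is false, Jarden–Ritter); nothing here bears on [IUTchIII] Cor. 3.12 or asserts that
abc is proved or refuted; typed ≠ proved elsewhere.
-/

noncomputable section

namespace Summit.ABC.IUTFork

open CategoryTheory
open Literature.AnabelianGeometry.AbsoluteAnabelian
open Literature.AnabelianGeometry.AbsoluteAnabelian.AbsTopIII (TopGroupObj)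
open Literature.AlgebraicGeometry.Frobenioids (IsSlimGroup)

universe v u

/-! ## §0 criterion on the isomorphism subcategory (`Core`) -/

/-- **§0 «id-rigid» for the UNDERLINED category**: if in a category `C` every automorphism of every object
that commutes with all automorphisms of that object is the identity, then the isomorphism subcategory `Core C`
is id-rigid (the component of an automorphism of `𝟭_{Core C}` at `X` is an automorphism of `X` commuting, by
naturality, with every automorphism of `X`).  Companion of `isIdRigid_of_aut_center_trivial` (same hypothesis,
conclusion for `C` itself). [cite: MochizukiAbsTopIII2015, Section 0 p.27] -/
theorem isIdRigid_core_of_iso_comm_eq_refl (C : Type u) [Category.{v} C]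
    (h : ∀ (X : C) (a : X ≅ X), (∀ b : X ≅ X, a ≪≫ b = b ≪≫ a) → a = Iso.refl X) :
    IsIdRigid (Core C) := by
  intro α
  have hX : ∀ X : Core C, (α.hom.app X).iso = Iso.refl X.of := by
    intro X
    refine h X.of _ fun b => ?_
    have hn := α.hom.naturality (X := X) (Y := X) (CoreHom.mk b)
    have hn' := congrArg CoreHom.iso hn
    simp only [Functor.id_obj, Functor.id_map, coreCategory_comp_iso] at hn'
    exact hn'.symm
  ext X
  simp [hX X]

/-! ## Sentence 2: bijectivity -/

/-- **Prop. 3.2 (iv), sentence 2 at `T = TM`, strictly Belyi type — UNCONDITIONAL for every hypothesis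
predicate `H`** (FACT-LIST F-2994, universal closure): the typed schema `GaloisIsoLiftsToTMPairIsoOfStrictlyBelyi H`
is the orbicurve-form schema (`galoisIsoLiftsToTMPairIsoOfStrictlyBelyi_iff`, abc-iut-L6-t13), which holds for
every `H` (`galoisIsoLiftsToTMPairIso_holds`, abc-iut-w6-d103: abstract isomorphisms of `G_k`'s are topological by
Nikolov–Segal at `G_k`, then the local class field theory route of the printed proof p. 72 l. 50 – p. 73 l. 4).
[cite: MochizukiAbsTopIII2015, Proposition 3.2 (iv) p.72] -/
theorem galoisIsoLiftsToTMPairIsoOfStrictlyBelyi_holds (H : GaloisMonoidPair.{0} → Prop) :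
    Literature.AnabelianGeometry.AbsoluteAnabelian.GaloisIsoLiftsToTMPairIsoOfStrictlyBelyi H :=
  (galoisIsoLiftsToTMPairIsoOfStrictlyBelyi_iff H).mpr (galoisIsoLiftsToTMPairIso_holds H)

/-- **Prop. 3.2 (iv), sentence 2 at `T = TF`, strictly Belyi type, FROM Prop. 3.2 (iii) BY NAME** («The
surjectivity portion of assertion (iv) follows from assertion (iii), when `(Π ↷ M_T)`, `(Π* ↷ M*_T)` are of
strictly Belyi type», proof p. 72 l. 49–50): given «the algorithm of (iii)», functorial «relative to `𝒞̲^MLF_T`»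
(abc-iut-L4-t9's datum `Prop32iiiAlgorithmTIso S` on print's carrier, the `T`-isomorphism subcategories), on a
class `S` of MLF-Galois `TF`-pairs with compact `Π` (standing for «of strictly Belyi type»), every admissible
`Π ⥲ Π*` between `S`-pairs lifts to an isomorphism of `TF`-pairs — the typed schema
`GaloisIsoLiftsToTFPairIsoOfStrictlyBelyi` (FACT-LIST F-2995) AT the predicate «in `S`».  One-line over
abc-iut-L4-t9's `galoisIsoLiftsToTFPairIso_of_nonempty_prop32iiiAlgorithmTIso`.
[cite: MochizukiAbsTopIII2015, Proposition 3.2 (iv) p.72] -/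
theorem galoisIsoLiftsToTFPairIsoOfStrictlyBelyi_of_prop32iiiAlgorithmTIso
    (S : ObjectProperty MLFGaloisFieldPairCompactCat.{0}) (A : Prop32iiiAlgorithmTIso S) :
    Literature.AnabelianGeometry.AbsoluteAnabelian.GaloisIsoLiftsToTFPairIsoOfStrictlyBelyi
      (fun P => ∃ hP : IsMLFGaloisFieldPair P ∧ CompactSpace P.Pi, S ⟨P, hP⟩) :=
  galoisIsoLiftsToTFPairIso_of_nonempty_prop32iiiAlgorithmTIso S ⟨A⟩

/-- The same from the algorithm of (iii) functorial on the ISOMORPHISM subcategory only (abc-iut-L4-t9's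
`Prop32iiiAlgorithmIso S`; equivalent to F-2995 on `S`, `nonempty_prop32iiiAlgorithmIso_iff_galoisIsoLiftsToTFPairIso`).
[cite: MochizukiAbsTopIII2015, Proposition 3.2 (iv) p.72] -/
theorem galoisIsoLiftsToTFPairIsoOfStrictlyBelyi_of_prop32iiiAlgorithmIso
    (S : ObjectProperty MLFGaloisFieldPairCompactCat.{0}) (A : Prop32iiiAlgorithmIso S) :
    Literature.AnabelianGeometry.AbsoluteAnabelian.GaloisIsoLiftsToTFPairIsoOfStrictlyBelyi
      (fun P => ∃ hP : IsMLFGaloisFieldPair P ∧ CompactSpace P.Pi, S ⟨P, hP⟩) :=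
  (nonempty_prop32iiiAlgorithmIso_iff_galoisIsoLiftsToTFPairIso S).mp ⟨A⟩

/-! ## Sentence 3: inner automorphisms and centre-freeness, input [AbsTopI] Prop. 2.3 (ii) BY NAME -/

/-- **Sentence 3, «contains the subgroup … determined by the inner automorphisms of `Π`», `T = TM`**: every inner
automorphism of `Π` is the Galois component of an automorphism of the pair (abc-iut-w4-d045's
`GaloisMonoidPair.Iso.conj`). [cite: MochizukiAbsTopIII2015, Proposition 3.2 (iv) p.72] -/
theorem exists_pairIso_isoPi_eq_conj (P : GaloisMonoidPair.{u}) (g : P.Pi) :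
    ∃ e : GaloisMonoidPair.Iso P P, ∀ h : P.Pi, e.isoPi h = g * h * g⁻¹ :=
  ⟨GaloisMonoidPair.Iso.conj P g, fun _ => rfl⟩

/-- **Sentence 3, inner automorphisms, `T = TF`** (`GaloisFieldPair.Iso.conj`).
[cite: MochizukiAbsTopIII2015, Proposition 3.2 (iv) p.72] -/
theorem exists_fieldPairIso_isoPi_eq_conj (P : GaloisFieldPair.{u}) (g : P.Pi) :
    ∃ e : GaloisFieldPair.Iso P P, ∀ h : P.Pi, e.isoPi h = g * h * g⁻¹ :=
  ⟨GaloisFieldPair.Iso.conj P g, fun _ => rfl⟩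

/-- **[AbsTopI] Prop. 2.3 (ii) BY NAME, transported**: a topological group isomorphic to the `Π` of an extension
`1 → Δ → Π → G → 1` satisfying the typed [AbsTopI] Prop. 2.3 (ii) (`FundamentalExtension.ArithSlimNotElastic`,
FACT-LIST F-0238: «`Π` is slim, but not elastic») is slim. [cite: MochizukiAbsTopI2012, Prop 2.3 (ii) p.19] -/
theorem isSlimGroup_of_arithSlimNotElastic {G : Type} [Group G] [TopologicalSpace G]
    (h : ∃ E : FundamentalExtension.{0}, E.ArithSlimNotElastic ∧ Nonempty (G ≃ₜ* E.arith)) :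
    IsSlimGroup G := by
  obtain ⟨E, ⟨hslim, _⟩, ⟨e⟩⟩ := h
  exact (isSlimGroup_congr e).mpr hslim

/-- **[AbsTopI] Prop. 2.3 (ii) from Prop. 2.3 (i) at an MLF base, transported**: a topological group isomorphic
to the `Π` of an extension with MLF base data (`G ≅ G_k`) and slim `Δ` is slim — the step «`Δ` slim ⇒ `Π` slim»
is a theorem of the tree (`FundamentalExtension.MLFBase.isSlimGroup_arith`, with `G_k` slim from
`galoisMLF_slim_holds`). [cite: MochizukiAbsTopI2012, Prop 2.3 (ii) p.19] -/
theorem isSlimGroup_of_mlfBase_of_geom_slim {G : Type} [Group G] [TopologicalSpace G]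
    (h : ∃ E : FundamentalExtension.{0}, Nonempty E.MLFBase ∧ IsSlimGroup E.geom ∧ Nonempty (G ≃ₜ* E.arith)) :
    IsSlimGroup G := by
  obtain ⟨E, ⟨B⟩, hΔ, ⟨e⟩⟩ := h
  exact (isSlimGroup_congr e).mpr (B.isSlimGroup_arith hΔ)

/-- **Sentence 3, `T = TM`**: «if `(Π ↷ M_T)` is of hyperbolic orbicurve type, then `Aut_{𝒞^MLF_TM}((Π ↷ M_T))` …
is center-free» — for every hypothesis predicate `H` whose pairs have `Π ≅ Π_X` for an extension satisfying
[AbsTopI] Prop. 2.3 (ii) BY NAME (`ArithSlimNotElastic`, F-0238).  Deduction = the printed one (abc-iut-L6-t13's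
`autPairCenterFree_of_isSlimGroup`: injectivity + `Z(Π) = 1`). [cite: MochizukiAbsTopIII2015, Proposition 3.2 (iv) p.72] -/
theorem autPairCenterFree_of_arithSlimNotElastic {H : GaloisMonoidPair.{0} → Prop}
    (hH : ∀ P : GaloisMonoidPair.{0}, IsMLFGaloisMonoidPair .TM P → H P →
      ∃ E : FundamentalExtension.{0}, E.ArithSlimNotElastic ∧ Nonempty (P.Pi ≃ₜ* E.arith)) :
    AutPairCenterFree H :=
  autPairCenterFree_of_isSlimGroup fun P hP hHP => isSlimGroup_of_arithSlimNotElastic (hH P hP hHP)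

/-- **Sentence 3, `T = TM`, from [AbsTopI] Prop. 2.3 (i) + MLF base**: for every `H` whose pairs have `Π ≅ Π_X` for
an extension with MLF base data and slim `Δ`. [cite: MochizukiAbsTopIII2015, Proposition 3.2 (iv) p.72] -/
theorem autPairCenterFree_of_mlfBase_of_geom_slim {H : GaloisMonoidPair.{0} → Prop}
    (hH : ∀ P : GaloisMonoidPair.{0}, IsMLFGaloisMonoidPair .TM P → H P →
      ∃ E : FundamentalExtension.{0}, Nonempty E.MLFBase ∧ IsSlimGroup E.geom ∧ Nonempty (P.Pi ≃ₜ* E.arith)) :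
    AutPairCenterFree H :=
  autPairCenterFree_of_isSlimGroup fun P hP hHP => isSlimGroup_of_mlfBase_of_geom_slim (hH P hP hHP)

/-- **Sentence 3, `T = TF`**: «`Aut_{𝒞^MLF_TF}((Π ↷ M_TF))` … is center-free» for every `H` whose pairs have
`Π ≅ Π_X` for an extension satisfying [AbsTopI] Prop. 2.3 (ii) BY NAME (abc-iut-w4-d045's
`autFieldPairCenterFree_of_isSlimGroup'`). [cite: MochizukiAbsTopIII2015, Proposition 3.2 (iv) p.72] -/
theorem autFieldPairCenterFree_of_arithSlimNotElastic {H : GaloisFieldPair.{0} → Prop}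
    (hH : ∀ P : GaloisFieldPair.{0}, IsMLFGaloisFieldPair P → H P →
      ∃ E : FundamentalExtension.{0}, E.ArithSlimNotElastic ∧ Nonempty (P.Pi ≃ₜ* E.arith)) :
    AutFieldPairCenterFree H :=
  autFieldPairCenterFree_of_isSlimGroup' fun P hP hHP => isSlimGroup_of_arithSlimNotElastic (hH P hP hHP)

/-- **Sentence 3, `T = TF`, from [AbsTopI] Prop. 2.3 (i) + MLF base**.
[cite: MochizukiAbsTopIII2015, Proposition 3.2 (iv) p.72] -/
theorem autFieldPairCenterFree_of_mlfBase_of_geom_slim {H : GaloisFieldPair.{0} → Prop}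
    (hH : ∀ P : GaloisFieldPair.{0}, IsMLFGaloisFieldPair P → H P →
      ∃ E : FundamentalExtension.{0}, Nonempty E.MLFBase ∧ IsSlimGroup E.geom ∧ Nonempty (P.Pi ≃ₜ* E.arith)) :
    AutFieldPairCenterFree H :=
  autFieldPairCenterFree_of_isSlimGroup' fun P hP hHP => isSlimGroup_of_mlfBase_of_geom_slim (hH P hP hHP)

/-! ## Sentence 4: id-rigidity, including the underlined (isomorphism-subcategory) versions -/

/-- Centre-freeness of `Aut_{𝒞^MLF_TM}` (the schema `AutPairCenterFree H`) in §0's form on the full subcategory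
`𝒞^{MLF-H}_TM`: an automorphism of an object commuting with every automorphism of that object is the identity
(abc-iut-w4-d045's argument inside `prop32iv_idRigid_TM_of_autPairCenterFree`, exposed as a statement about
isomorphisms so that it serves BOTH `𝒞` and `𝒞̲`). [cite: MochizukiAbsTopIII2015, Proposition 3.2 (iv) p.72] -/
theorem mlfGaloisMonoidPairSubcat_iso_comm_eq_refl {H : GaloisMonoidPair.{0} → Prop}
    (hH : AutPairCenterFree H) (X : MLFGaloisMonoidPairSubcat.{0} .TM H) (a : X ≅ X)
    (ha : ∀ b : X ≅ X, a ≪≫ b = b ≪≫ a) : a = Iso.refl X := by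
  obtain ⟨⟨P, hP⟩, hX⟩ := X
  let aP : GaloisMonoidPair.Iso P P := GaloisMonoidPair.isoOfCatIso
    ((ObjectProperty.ι _).mapIso ((ObjectProperty.ι _).mapIso a))
  have hcomm : ∀ e' : GaloisMonoidPair.Iso P P,
      (∀ x, aP.isoM (e'.isoM x) = e'.isoM (aP.isoM x)) ∧ ∀ g, aP.isoPi (e'.isoPi g) = e'.isoPi (aP.isoPi g) := by
    intro e'
    let b : (⟨⟨P, hP⟩, hX⟩ : MLFGaloisMonoidPairSubcat.{0} .TM H) ≅ ⟨⟨P, hP⟩, hX⟩ :=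
      (ObjectProperty.fullyFaithfulι _).preimageIso ((ObjectProperty.fullyFaithfulι _).preimageIso e'.toCatIso)
    have hab : (a.hom ≫ b.hom).hom.hom = (b.hom ≫ a.hom).hom.hom :=
      congrArg (fun φ => φ.hom.hom) (congrArg Iso.hom (ha b))
    have hM : ∀ x, e'.isoM (aP.isoM x) = aP.isoM (e'.isoM x) := fun x =>
      congrArg (fun φ : P.Hom P => φ.homM x) hab
    have hPi : ∀ g, e'.isoPi (aP.isoPi g) = aP.isoPi (e'.isoPi g) := fun g =>
      congrArg (fun φ : P.Hom P => φ.homPi g) hab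
    exact ⟨fun x => (hM x).symm, fun g => (hPi g).symm⟩
  obtain ⟨hMid, hPiId⟩ := hH P hP hX aP (fun e' => (hcomm e').1) (fun e' => (hcomm e').2)
  refine Iso.ext (ObjectProperty.hom_ext _ (ObjectProperty.hom_ext _
    (GaloisMonoidPair.Hom.ext (MonoidHom.ext fun g => ?_) (MonoidHom.ext fun x => ?_))))
  · exact hPiId g
  · exact hMid x

/-- The same for `T = TF` (abc-iut-w4-d045's argument inside `prop32iv_idRigidTF_of_autFieldPairCenterFree`).
[cite: MochizukiAbsTopIII2015, Proposition 3.2 (iv) p.72] -/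
theorem mlfGaloisFieldPairSubcat_iso_comm_eq_refl {H : GaloisFieldPair.{0} → Prop}
    (hH : AutFieldPairCenterFree H) (X : MLFGaloisFieldPairSubcat.{0} H) (a : X ≅ X)
    (ha : ∀ b : X ≅ X, a ≪≫ b = b ≪≫ a) : a = Iso.refl X := by
  obtain ⟨⟨P, hP⟩, hX⟩ := X
  let aP : GaloisFieldPair.Iso P P := GaloisFieldPair.isoOfCatIso
    ((ObjectProperty.ι _).mapIso ((ObjectProperty.ι _).mapIso a))
  have hcomm : ∀ e' : GaloisFieldPair.Iso P P,
      (∀ x, aP.isoM (e'.isoM x) = e'.isoM (aP.isoM x)) ∧ ∀ g, aP.isoPi (e'.isoPi g) = e'.isoPi (aP.isoPi g) := by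
    intro e'
    let b : (⟨⟨P, hP⟩, hX⟩ : MLFGaloisFieldPairSubcat.{0} H) ≅ ⟨⟨P, hP⟩, hX⟩ :=
      (ObjectProperty.fullyFaithfulι _).preimageIso ((ObjectProperty.fullyFaithfulι _).preimageIso e'.toCatIso)
    have hab : (a.hom ≫ b.hom).hom.hom = (b.hom ≫ a.hom).hom.hom :=
      congrArg (fun φ => φ.hom.hom) (congrArg Iso.hom (ha b))
    have hM : ∀ x, e'.isoM (aP.isoM x) = aP.isoM (e'.isoM x) := fun x =>
      congrArg (fun φ : P.Hom P => φ.homM x) hab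
    have hPi : ∀ g, e'.isoPi (aP.isoPi g) = aP.isoPi (e'.isoPi g) := fun g =>
      congrArg (fun φ : P.Hom P => φ.homPi g) hab
    exact ⟨fun x => (hM x).symm, fun g => (hPi g).symm⟩
  obtain ⟨hMid, hPiId⟩ := hH P hP hX aP (fun e' => (hcomm e').1) (fun e' => (hcomm e').2)
  refine Iso.ext (ObjectProperty.hom_ext _ (ObjectProperty.hom_ext _
    (GaloisFieldPair.Hom.ext (MonoidHom.ext fun g => ?_) (RingHom.ext fun x => ?_))))
  · exact hPiId g
  · exact hMid x

/-- **Sentence 4, `𝒞̲^{MLF-H}_TM` (UNDERLINED: the isomorphism subcategory) is id-rigid** whenever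
`Aut_{𝒞^MLF_TM}((Π ↷ M))` is centre-free on `H` (`AutPairCenterFree H`).
[cite: MochizukiAbsTopIII2015, Proposition 3.2 (iv) p.72] -/
theorem isIdRigid_core_mlfGaloisMonoidPairSubcat_of_autPairCenterFree {H : GaloisMonoidPair.{0} → Prop}
    (hH : AutPairCenterFree H) : IsIdRigid (Core (MLFGaloisMonoidPairSubcat.{0} .TM H)) :=
  isIdRigid_core_of_iso_comm_eq_refl _ (mlfGaloisMonoidPairSubcat_iso_comm_eq_refl hH)

/-- **Sentence 4, `𝒞̲^{MLF-H}_TF` (UNDERLINED) is id-rigid** whenever `Aut_{𝒞^MLF_TF}((Π ↷ k̄))` is centre-free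
on `H`. [cite: MochizukiAbsTopIII2015, Proposition 3.2 (iv) p.72] -/
theorem isIdRigid_core_mlfGaloisFieldPairSubcat_of_autFieldPairCenterFree {H : GaloisFieldPair.{0} → Prop}
    (hH : AutFieldPairCenterFree H) : IsIdRigid (Core (MLFGaloisFieldPairSubcat.{0} H)) :=
  isIdRigid_core_of_iso_comm_eq_refl _ (mlfGaloisFieldPairSubcat_iso_comm_eq_refl hH)

/-- **Sentence 4 at `T = TM`, both `𝒞^{MLF-H}_TM` and `𝒞̲^{MLF-H}_TM`, input [AbsTopI] Prop. 2.3 (ii) BY NAME**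
(«follows immediately from the slimness of `Π`»). [cite: MochizukiAbsTopIII2015, Proposition 3.2 (iv) p.72] -/
theorem prop32iv_idRigid_TM_and_core_of_arithSlimNotElastic {H : GaloisMonoidPair.{0} → Prop}
    (hH : ∀ P : GaloisMonoidPair.{0}, IsMLFGaloisMonoidPair .TM P → H P →
      ∃ E : FundamentalExtension.{0}, E.ArithSlimNotElastic ∧ Nonempty (P.Pi ≃ₜ* E.arith)) :
    Prop32iv_idRigid.{0} .TM H ∧ IsIdRigid (Core (MLFGaloisMonoidPairSubcat.{0} .TM H)) :=
  ⟨prop32iv_idRigid_TM_of_autPairCenterFree (autPairCenterFree_of_arithSlimNotElastic hH),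
    isIdRigid_core_mlfGaloisMonoidPairSubcat_of_autPairCenterFree (autPairCenterFree_of_arithSlimNotElastic hH)⟩

/-- **Sentence 4 at `T = TF`, both `𝒞^{MLF-H}_TF` and `𝒞̲^{MLF-H}_TF`, input [AbsTopI] Prop. 2.3 (ii) BY NAME.**
[cite: MochizukiAbsTopIII2015, Proposition 3.2 (iv) p.72] -/
theorem prop32iv_idRigidTF_and_core_of_arithSlimNotElastic {H : GaloisFieldPair.{0} → Prop}
    (hH : ∀ P : GaloisFieldPair.{0}, IsMLFGaloisFieldPair P → H P →
      ∃ E : FundamentalExtension.{0}, E.ArithSlimNotElastic ∧ Nonempty (P.Pi ≃ₜ* E.arith)) :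
    Prop32iv_idRigidTF.{0} H ∧ IsIdRigid (Core (MLFGaloisFieldPairSubcat.{0} H)) :=
  ⟨prop32iv_idRigidTF_of_autFieldPairCenterFree (autFieldPairCenterFree_of_arithSlimNotElastic hH),
    isIdRigid_core_mlfGaloisFieldPairSubcat_of_autFieldPairCenterFree
      (autFieldPairCenterFree_of_arithSlimNotElastic hH)⟩

/-- **Sentence 4 at `𝒯𝔾̲^H`** (abc-iut-L4-t9's groupoid of topological groups `TopGroupObj`, Def. 3.1 (iii)), input
[AbsTopI] Prop. 2.3 (ii) BY NAME (abc-iut-w4-d045's `isIdRigid_topGroupSubcat_of_isSlimGroup`).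
[cite: MochizukiAbsTopIII2015, Proposition 3.2 (iv) p.72] -/
theorem isIdRigid_topGroupSubcat_of_arithSlimNotElastic {H : TopGroupObj → Prop}
    (hH : ∀ A : TopGroupObj, H A → ∃ E : FundamentalExtension.{0}, E.ArithSlimNotElastic ∧ Nonempty (A.G ≃ₜ* E.arith)) :
    IsIdRigid (ObjectProperty.FullSubcategory H) :=
  isIdRigid_topGroupSubcat_of_isSlimGroup fun A hA => isSlimGroup_of_arithSlimNotElastic (hH A hA)

/-! ## The node: [AbsTopIII] Prop. 3.2 (iv), all four sentences, `T ∈ {TM, TF}` -/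

/-- **Cone node AbsTopIII:Prop3.2(iv) — the four printed sentences of [AbsTopIII] Prop. 3.2 (iv) (as corrected by
Comments 2019 (5)), `T ∈ {TM, TF}`, as ONE conjunction over the typed statement of record** (abc-iut-L4-t2
`MonoidKummerMaps.lean`, abc-iut-w4-d045 `MonoidKummerMapsSub.lean`).  DATA binders: the hypothesis predicates
`Hm` / `Hf` / `Hg` («of hyperbolic orbicurve type» on `TM`-pairs, `TF`-pairs, topological groups) and the class `S`
(«of strictly Belyi type», MLF-Galois `TF`-pairs with compact `Π`).  `Prop`-BINDERS = the printed inputs BY NAME and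
nothing else: `hHm` / `hHf` / `hHg` = [AbsTopI] Prop. 2.3 (ii) («the slimness of `Π` [cf. [Mzk20], Proposition
2.3, (ii)]») in its typed form `FundamentalExtension.ArithSlimNotElastic` (FACT-LIST F-0238) at an extension
presenting `Π`; `A` = Prop. 3.2 (iii) («the algorithm of (iii)», functorial relative to `𝒞̲^MLF_T`, on `S`;
abc-iut-L4-t9's `Prop32iiiAlgorithmTIso S`).  CONCLUSION, in order: sentence 1 (`TM`, `TF`); sentence 2 (`TM`
for every predicate — the corrected orbicurve form F-0409 and the strictly-Belyi form F-2994 —, `TF` strictly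
Belyi F-2995 on `S`); sentence 3 (inner automorphisms lift, `TM`/`TF`; centre-free, `TM`/`TF`); sentence 4
(`𝒞^{MLF-H}_TM`, `𝒞̲^{MLF-H}_TM`, `𝒞^{MLF-H}_TF`, `𝒞̲^{MLF-H}_TF`, `𝒯𝔾̲^H` id-rigid).
[cite: MochizukiAbsTopIII2015, Proposition 3.2 (iv) p.72] [cite: MochizukiAbsTopIIIComments2019, item (5)] -/
theorem absTopIII_prop32iv
    (Hm : GaloisMonoidPair.{0} → Prop) (Hf : GaloisFieldPair.{0} → Prop) (Hg : TopGroupObj → Prop)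
    (hHm : ∀ P : GaloisMonoidPair.{0}, IsMLFGaloisMonoidPair .TM P → Hm P →
      ∃ E : FundamentalExtension.{0}, E.ArithSlimNotElastic ∧ Nonempty (P.Pi ≃ₜ* E.arith))
    (hHf : ∀ P : GaloisFieldPair.{0}, IsMLFGaloisFieldPair P → Hf P →
      ∃ E : FundamentalExtension.{0}, E.ArithSlimNotElastic ∧ Nonempty (P.Pi ≃ₜ* E.arith))
    (hHg : ∀ A : TopGroupObj, Hg A → ∃ E : FundamentalExtension.{0}, E.ArithSlimNotElastic ∧ Nonempty (A.G ≃ₜ* E.arith))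
    (S : ObjectProperty MLFGaloisFieldPairCompactCat.{0}) (A : Prop32iiiAlgorithmTIso S) :
    -- sentence 1: injectivity, `T = TM`, `T = TF`
    Literature.AnabelianGeometry.AbsoluteAnabelian.PairIsoDeterminedByGalois ∧
    Literature.AnabelianGeometry.AbsoluteAnabelian.FieldPairIsoDeterminedByGalois ∧
    -- sentence 2: bijectivity
    (∀ H, Literature.AnabelianGeometry.AbsoluteAnabelian.GaloisIsoLiftsToTMPairIso H) ∧
    (∀ H, Literature.AnabelianGeometry.AbsoluteAnabelian.GaloisIsoLiftsToTMPairIsoOfStrictlyBelyi H) ∧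
    Literature.AnabelianGeometry.AbsoluteAnabelian.GaloisIsoLiftsToTFPairIsoOfStrictlyBelyi
      (fun P => ∃ hP : IsMLFGaloisFieldPair P ∧ CompactSpace P.Pi, S ⟨P, hP⟩) ∧
    -- sentence 3: inner automorphisms lift; centre-freeness
    (∀ (P : GaloisMonoidPair.{0}) (g : P.Pi), ∃ e : GaloisMonoidPair.Iso P P, ∀ h, e.isoPi h = g * h * g⁻¹) ∧
    (∀ (P : GaloisFieldPair.{0}) (g : P.Pi), ∃ e : GaloisFieldPair.Iso P P, ∀ h, e.isoPi h = g * h * g⁻¹) ∧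
    Literature.AnabelianGeometry.AbsoluteAnabelian.AutPairCenterFree Hm ∧
    Literature.AnabelianGeometry.AbsoluteAnabelian.AutFieldPairCenterFree Hf ∧
    -- sentence 4: id-rigidity (plain and underlined carriers)
    Literature.AnabelianGeometry.AbsoluteAnabelian.Prop32iv_idRigid.{0} .TM Hm ∧
    IsIdRigid (Core (MLFGaloisMonoidPairSubcat.{0} .TM Hm)) ∧
    Literature.AnabelianGeometry.AbsoluteAnabelian.Prop32iv_idRigidTF.{0} Hf ∧
    IsIdRigid (Core (MLFGaloisFieldPairSubcat.{0} Hf)) ∧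
    IsIdRigid (ObjectProperty.FullSubcategory Hg) :=
  ⟨pairIsoDeterminedByGalois_holds, fieldPairIsoDeterminedByGalois_holds,
    galoisIsoLiftsToTMPairIso_holds, galoisIsoLiftsToTMPairIsoOfStrictlyBelyi_holds,
    galoisIsoLiftsToTFPairIsoOfStrictlyBelyi_of_prop32iiiAlgorithmTIso S A,
    exists_pairIso_isoPi_eq_conj, exists_fieldPairIso_isoPi_eq_conj,
    autPairCenterFree_of_arithSlimNotElastic hHm, autFieldPairCenterFree_of_arithSlimNotElastic hHf,
    (prop32iv_idRigid_TM_and_core_of_arithSlimNotElastic hHm).1,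
    (prop32iv_idRigid_TM_and_core_of_arithSlimNotElastic hHm).2,
    (prop32iv_idRigidTF_and_core_of_arithSlimNotElastic hHf).1,
    (prop32iv_idRigidTF_and_core_of_arithSlimNotElastic hHf).2,
    isIdRigid_topGroupSubcat_of_arithSlimNotElastic hHg⟩

end Summit.ABC.IUTFork


/-! ## v2 (append-only, abc-iut-L6-t13 gen 8, after L4-d3's count read 16:23:23Z / L4-lead COUNT 81): the node in
COUNT-LABEL form — the `TF` strictly-Belyi antecedent read (ruling #5k) as the typed clause F-2995 ON `S` by id (⟺ the
(iii)-algorithm on the isomorphism subcategory, p432307) instead of the `𝒞̲`-datum.  Nothing above is edited. -/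

namespace Summit.ABC.IUTFork

open CategoryTheory Literature.AnabelianGeometry.AbsoluteAnabelian AbsTopIII in
/-- **Cone node AbsTopIII:Prop3.2(iv), COUNT-LABEL form**: the thirteen conjuncts of `absTopIII_prop32iv`, explicit
`Prop`-binders EXACTLY `hHm`/`hHf`/`hHg` = [AbsTopI] Prop. 2.3 (ii) BY NAME (F-0238, ×3 carriers) and `hF` = F-2995
ON `S` (conjunct 5 is `hF` itself; print's «follows from assertion (iii)» is the equivalence p432307).
[cite: MochizukiAbsTopIII2015, Proposition 3.2 (iv) p.72] [cite: MochizukiAbsTopIIIComments2019, item (5)] -/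
theorem absTopIII_prop32iv_of_galoisIsoLiftsToTFPairIso
    (Hm : GaloisMonoidPair.{0} → Prop) (Hf : GaloisFieldPair.{0} → Prop) (Hg : TopGroupObj → Prop)
    (hHm : ∀ P : GaloisMonoidPair.{0}, IsMLFGaloisMonoidPair .TM P → Hm P →
      ∃ E : FundamentalExtension.{0}, E.ArithSlimNotElastic ∧ Nonempty (P.Pi ≃ₜ* E.arith))
    (hHf : ∀ P : GaloisFieldPair.{0}, IsMLFGaloisFieldPair P → Hf P →
      ∃ E : FundamentalExtension.{0}, E.ArithSlimNotElastic ∧ Nonempty (P.Pi ≃ₜ* E.arith))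
    (hHg : ∀ A : TopGroupObj, Hg A → ∃ E : FundamentalExtension.{0}, E.ArithSlimNotElastic ∧ Nonempty (A.G ≃ₜ* E.arith))
    (S : ObjectProperty MLFGaloisFieldPairCompactCat.{0})
    (hF : GaloisIsoLiftsToTFPairIsoOfStrictlyBelyi (fun P => ∃ hP : IsMLFGaloisFieldPair P ∧ CompactSpace P.Pi, S ⟨P, hP⟩)) :
    PairIsoDeterminedByGalois ∧ FieldPairIsoDeterminedByGalois ∧
    (∀ H, GaloisIsoLiftsToTMPairIso H) ∧ (∀ H, GaloisIsoLiftsToTMPairIsoOfStrictlyBelyi H) ∧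
    GaloisIsoLiftsToTFPairIsoOfStrictlyBelyi (fun P => ∃ hP : IsMLFGaloisFieldPair P ∧ CompactSpace P.Pi, S ⟨P, hP⟩) ∧
    (∀ (P : GaloisMonoidPair.{0}) (g : P.Pi), ∃ e : GaloisMonoidPair.Iso P P, ∀ h, e.isoPi h = g * h * g⁻¹) ∧
    (∀ (P : GaloisFieldPair.{0}) (g : P.Pi), ∃ e : GaloisFieldPair.Iso P P, ∀ h, e.isoPi h = g * h * g⁻¹) ∧
    AutPairCenterFree Hm ∧ AutFieldPairCenterFree Hf ∧
    Prop32iv_idRigid.{0} .TM Hm ∧ IsIdRigid (Core (MLFGaloisMonoidPairSubcat.{0} .TM Hm)) ∧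
    Prop32iv_idRigidTF.{0} Hf ∧ IsIdRigid (Core (MLFGaloisFieldPairSubcat.{0} Hf)) ∧
    IsIdRigid (ObjectProperty.FullSubcategory Hg) :=
  ⟨pairIsoDeterminedByGalois_holds, fieldPairIsoDeterminedByGalois_holds,
    galoisIsoLiftsToTMPairIso_holds, galoisIsoLiftsToTMPairIsoOfStrictlyBelyi_holds, hF,
    exists_pairIso_isoPi_eq_conj, exists_fieldPairIso_isoPi_eq_conj,
    autPairCenterFree_of_arithSlimNotElastic hHm, autFieldPairCenterFree_of_arithSlimNotElastic hHf,
    (prop32iv_idRigid_TM_and_core_of_arithSlimNotElastic hHm).1,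
    (prop32iv_idRigid_TM_and_core_of_arithSlimNotElastic hHm).2,
    (prop32iv_idRigidTF_and_core_of_arithSlimNotElastic hHf).1,
    (prop32iv_idRigidTF_and_core_of_arithSlimNotElastic hHf).2,
    isIdRigid_topGroupSubcat_of_arithSlimNotElastic hHg⟩

end Summit.ABC.IUTFork

end
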